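import Literature.AnabelianGeometry.EtaleTheta.Discharge.Sec5OfTemperoidModelData
import Literature.AnabelianGeometry.EtaleTheta.Discharge.Sec5RootDivisorInvariance

/-!
# [EtTh] §5 over the temperoid: the divisor inputs `hinvc` / `hinvp` FROM the `Π^tp_X`-stability of `Div(Θ̈)_±` (Prop. 4.3 (i) proof, p.317; §5 p.330 / PDF pp.91, 104)

Mochizuki, *The étale theta function …*, Publ. RIMS **45** (2009)
[cite: MochizukiEtTh2009, Prop 4.3 (i) p.317 (PDF p.91); §5 p.330 (PDF p.104)].  Seat abc-iut-L2-t4 (§5 owner), ROW W3-L2-01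
«§5 GENUINE DATA»; PROOF-ONLY corollary of `Discharge/Sec5OfTemperoidModelData.lean` (p423781) and
`Discharge/Sec5RootDivisorInvariance.lean` (p424696).  Additive.

Over the genuine tempered base `B^temp(Π^tp_X)` (`BiKummerSetting.mkOfTemperoid`) the naturality law `hS` of the Galois surjections
is the THEOREM `mkOfTemperoid_galoisSurj_natural` and `Φ` is divisorial by the [FrdI] Thm. 5.2 hypotheses `h`; hence the two divisor
inputs `hinvc`, `hinvp` of `ThetaFrobenioid.ofTemperoidData` / `ThetaFrobenioidTower.ofTemperoidFamily` follow from ONE printed input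
each: the `Π^tp_X`-stability `hθ` of `Div(s')` and `hθ'` of `Div(s'')`, `(s', s'')` the chosen right fraction-pair of `Θ̈` on `A_⊙`
(the positive / negative parts of the divisor of `Θ̈`; Prop. 1.4: supported on the special fibre and the cusps, `Π^tp_X`-stable) —
`hinvc_ofTemperoid`, `hinvp_ofTemperoid` (one level), `hinvc_family_ofTemperoid`, `hinvp_family_ofTemperoid` (all levels of a family
of roots `R N` of the `l`-th root `Rl`); and the binder `hH` (`Π^tp_Ÿ ⊆ H_⊙`) becomes the concrete condition "`Π^tp_Ÿ` fixes a
point of `A_⊙^bs`" (`GaloisObjects.mem_ker_galoisSurjOf_iff_apply`: the kernel of `Π ↠ Aut(A)` is the stabiliser of EVERY point of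
a Galois object; `mem_Hodot_mkOfTemperoid_iff`, `hH_mkOfTemperoid_of_fixes`).  With these, the §5 data over the temperoid take as inputs exactly: `h`, `Q`, the roots,
`ιX`, the constants `(K', constEmb)`, `hθ`, `hθ'` (+ for `Facts`: `hH`, `hconst`, `hgc`; for the tower: the Rmk. 4.3.2 transitions).
HONEST FRAMING: kernel-checked implications over abc-iut-L2-t3's / abc-iut-L3's data structures; no side taken downstream.
-/

noncomputable section

/-! ## `Ker(Π ↠ Aut(A))` is the stabiliser of every point of a Galois object -/

namespace Literature.AnabelianGeometry.SemiGraphs.GaloisObjects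

open CategoryTheory Literature.AlgebraicGeometry.Frobenioids Literature.AlgebraicGeometry.Frobenioids.QuasiTemperoid.BTempConnected

universe u

variable {G : Type u} [Group G] [TopologicalSpace G] [IsTopologicalGroup G] (hG : IsTempered G) (A : BTemp G)
  (hA : IsGaloisObj A)

/-- **The kernel of the Galois surjection `Π ↠ Aut(A)` of a Galois object `A ≅ Π/N_A` is the stabiliser of EVERY point of `A`**
(all stabilisers of a Galois object coincide with the normal subgroup `N_A`; [SemiAnbd] Rmk. 3.1.3) — so "`Π' ⊆ Ker`" is the
concrete condition "`Π'` fixes a point of `A`", i.e. "`A` is dominated by the covering of `Π'`".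
[cite: MochizukiSemiAnbd2006, Rmk 3.1.3 p.34] -/
theorem mem_ker_galoisSurjOf_iff_apply (x : A.obj.V) (g : G) :
    g ∈ (galoisSurjOf hG A hA).ker ↔ A.obj.ρ g x = x := by
  obtain ⟨a, rfl⟩ := exists_ρ_galoisBase_eq hG A hA x
  have hn : (galoisSurjOf hG A hA).ker.Normal := inferInstance
  constructor
  · intro hg
    have h1 : a⁻¹ * g * a⁻¹⁻¹ ∈ (galoisSurjOf hG A hA).ker := hn.conj_mem g hg a⁻¹
    rw [inv_inv, mem_ker_galoisSurjOf_iff, ρ_mul_apply, ρ_mul_apply] at h1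
    have h2 := congrArg (A.obj.ρ a) h1
    rwa [ρ_apply_inv] at h2
  · intro h
    have h1 : a⁻¹ * g * a ∈ (galoisSurjOf hG A hA).ker := by
      rw [mem_ker_galoisSurjOf_iff, ρ_mul_apply, ρ_mul_apply, h, ρ_inv_apply]
    have h2 := hn.conj_mem _ h1 a
    rwa [← mul_assoc, ← mul_assoc, mul_inv_cancel, one_mul, mul_assoc, mul_inv_cancel, mul_one] at h2

end Literature.AnabelianGeometry.SemiGraphs.GaloisObjects

namespace Literature.AnabelianGeometry.EtaleTheta

open CategoryTheory Opposite Literature.AlgebraicGeometry.Frobenioids Literature.AnabelianGeometry.SemiGraphs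
  Literature.AnabelianGeometry.SemiGraphs.GaloisObjects

universe u₀ v₀ w

namespace BiKummerSetting

variable {K : Type u₀} [Field K] (X : SemiGraphs.TemperedArithmeticGroup.{u₀} K) {D₀ : Type u₀} [Category.{v₀} D₀]
  {V : FrdIMonoidStub.{w}} {T₀ : RealifiedDivisorMonoids (D₀ := D₀) V} {VD : FrdICatStub.{u₀ + 1, u₀, w} (BTemp X.Pi)}
  (tf : TemperedFrobenioid T₀ (BTemp X.Pi) VD) (hZ : tf.monoidType = MonoidType.Z)
  (hP : ∀ A : (BTemp X.Pi)ᵒᵖ, IsPerfect (tf.Φ.carrier A))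
  (NH : Subgroup (Field.absoluteGaloisGroup K) → tf.category → ℕ+ → Prop) (A₀ : tf.category)
  (hA₀ : PreFrobenioid.IsFrobeniusTrivial tf.toElem A₀) (hA₀' : SemiGraphs.IsGaloisObj A₀.base)

/-- **`H_⊙` over the temperoid is the stabiliser of every point of `A_⊙^bs`** (p.312 (PDF p.86): `H_⊙` "the open subgroup
determined by `A_⊙`").  [cite: MochizukiEtTh2009, Def 4.1 p.312 (PDF p.86)] -/
theorem mem_Hodot_mkOfTemperoid_iff (x : A₀.base.obj.V) (g : X.Pi) :
    g ∈ (mkOfTemperoid X tf hZ hP NH A₀ hA₀ hA₀').Hodot ↔ A₀.base.obj.ρ g x = x :=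
  mem_ker_galoisSurjOf_iff_apply X.isTempered A₀.base hA₀' x g

/-- **The §5 binder `hH` (`Π^tp_Ÿ ⊆ H_⊙`) in concrete form over the temperoid**: it holds as soon as `Π^tp_Ÿ` (read in `Π^tp_X`
through `ιX`) fixes one point of `A_⊙^bs` — i.e. `A_⊙^bs` is dominated by `Ÿ` (§5 p.330 (PDF p.104)).
[cite: MochizukiEtTh2009, §5 p.330 (PDF p.104); Def 4.1 p.312 (PDF p.86)] -/
theorem hH_mkOfTemperoid_of_fixes {P : Type*} [Group P] [TopologicalSpace P] (ιX : P ≃ₜ* X.Pi) (PiYdd : Subgroup P)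
    (x : A₀.base.obj.V) (hfix : ∀ y : P, y ∈ PiYdd → A₀.base.obj.ρ (ιX y) x = x) :
    ∀ y : P, y ∈ PiYdd → ιX y ∈ (mkOfTemperoid X tf hZ hP NH A₀ hA₀ hA₀').Hodot :=
  fun y hy => (mem_Hodot_mkOfTemperoid_iff X tf hZ hP NH A₀ hA₀ hA₀' x (ιX y)).2 (hfix y hy)

end BiKummerSetting

namespace ThetaFrobenioid

variable {K : Type u₀} [Field K] {X : SemiGraphs.TemperedArithmeticGroup.{u₀} K} {D₀ : Type u₀} [Category.{v₀} D₀]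
  {V : FrdIMonoidStub.{w}} {T₀ : RealifiedDivisorMonoids (D₀ := D₀) V} {VD : FrdICatStub.{u₀ + 1, u₀, w} (BTemp X.Pi)}
  {tf : TemperedFrobenioid T₀ (BTemp X.Pi) VD} {hZ : tf.monoidType = MonoidType.Z}
  {hP : ∀ A : (BTemp X.Pi)ᵒᵖ, IsPerfect (tf.Φ.carrier A)}
  {NH : Subgroup (Field.absoluteGaloisGroup K) → tf.category → ℕ+ → Prop} {A₀ : tf.category}
  {hA₀ : PreFrobenioid.IsFrobeniusTrivial tf.toElem A₀} {hA₀' : SemiGraphs.IsGaloisObj A₀.base}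
  {pullFrac : ∀ {A A' : (BiKummerSetting.mkOfTemperoid X tf hZ hP NH A₀ hA₀ hA₀').C} (_ : A' ⟶ A),
    (BiKummerSetting.mkOfTemperoid X tf hZ hP NH A₀ hA₀ hA₀').biratUnits A →
      (BiKummerSetting.mkOfTemperoid X tf hZ hP NH A₀ hA₀ hA₀').biratUnits A'}
  {lv : ℕ+} {θ : (BiKummerSetting.mkOfTemperoid X tf hZ hP NH A₀ hA₀ hA₀').biratUnits
    (BiKummerSetting.mkOfTemperoid X tf hZ hP NH A₀ hA₀ hA₀').Aodot}
  {Bl : (BiKummerSetting.mkOfTemperoid X tf hZ hP NH A₀ hA₀ hA₀').C}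
  {Pl : (BiKummerSetting.mkOfTemperoid X tf hZ hP NH A₀ hA₀ hA₀').FractionPair θ Bl}
  {Rl : (BiKummerSetting.mkOfTemperoid X tf hZ hP NH A₀ hA₀ hA₀').NthRoot θ Pl lv pullFrac}
  (h : ModelFrobenioid.Hypotheses tf.divisorMonoid tf.ratFnFunctor)
  (hθ : ∀ x : X.Pi, pull tf.divisorMonoid (galoisSurjOf X.isTempered A₀.base hA₀' x).hom (ModelFrobenioid.div Pl.num) =
    ModelFrobenioid.div Pl.num)
  (hθ' : ∀ x : X.Pi, pull tf.divisorMonoid (galoisSurjOf X.isTempered A₀.base hA₀' x).hom (ModelFrobenioid.div Pl.den) =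
    ModelFrobenioid.div Pl.den)

section OneLevel

variable {N : ℕ+} {T : ThetaEnvData.{max u₀ w} N}
  (R : (BiKummerSetting.mkOfTemperoid X tf hZ hP NH A₀ hA₀ hA₀').NthRoot Rl.root Rl.pair N pullFrac) (ιX : T.PiX ≃ₜ* X.Pi)

include h hθ in
/-- **`hinvc` of `ofTemperoidData` from the stability of `Div(Θ̈)₊`**: over the temperoid, `Φ(g)(Div s^⊓_N) = Div s^⊓_N` for every
`g ∈ Aut(A_N^bs)` as soon as `Div(s')` is `Π^tp_X`-stable on `A_⊙^bs` (§5 p.330 (PDF p.104): "`Div(s^⊓_N)` … descends to `A_⊚`";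
naturality `hS` a theorem here, `Φ` divisorial by `h`).  [cite: MochizukiEtTh2009, §5 p.330 (PDF p.104); Prop 4.3 (i) p.317 (PDF p.91)] -/
theorem hinvc_ofTemperoid (g : Aut R.AN.base) :
    pull tf.divisorMonoid g.hom (ModelFrobenioid.div R.pair.num) = ModelFrobenioid.div R.pair.num :=
  hinvc_of_thetaDivisor R h.isDivisorial (BiKummerSetting.mkOfTemperoid_galoisSurj_natural X tf hZ hP NH A₀ hA₀ hA₀') hθ g

include h hθ' in
/-- **`hinvp` of `ofTemperoidData` from the stability of `Div(Θ̈)₋`**: over the temperoid, `Φ(ρ_{A_N}(y))(Div s^⊔_N) = Div s^⊔_N`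
for `y ∈ Π^tp_Ÿ` (indeed all `y`) as soon as `Div(s'')` is `Π^tp_X`-stable on `A_⊙^bs` (Prop. 4.3 (i) proof, p.317 (PDF p.91)).
[cite: MochizukiEtTh2009, Prop 4.3 (i) p.317 (PDF p.91)] -/
theorem hinvp_ofTemperoid (y : T.PiX) (hy : y ∈ T.PiYdd) :
    pull tf.divisorMonoid (galoisSurjOf X.isTempered R.AN.base R.αData.isGalois (ιX y)).hom
      (ModelFrobenioid.div R.pair.den) = ModelFrobenioid.div R.pair.den :=
  hinvp_of_thetaDivisor R ιX h.isDivisorial (BiKummerSetting.mkOfTemperoid_galoisSurj_natural X tf hZ hP NH A₀ hA₀ hA₀') hθ'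
    y hy

include hθ hθ' in
/-- **`Facts` for the §5 data over the temperoid built from the `Θ̈`-divisor stabilities** (`hinvc := hinvc_ofTemperoid`,
`hinvp := hinvp_ofTemperoid`), from `hH`, `hconst`, `hgc`.  [cite: MochizukiEtTh2009, §5 p.330–331 (PDF pp.104–105); Lem 5.8 p.331 (PDF p.105)] -/
theorem facts_ofTemperoidData_thetaDivisor (Q : FrobenioidTheta.ThetaSubquotientStub.{w} (BTemp X.Pi)) (odd_l : Odd (lv : ℕ))
    (K' : Type w) [Field K'] (constEmb : K'ˣ →* tf.biratUnitsModel R.BN) (constEmb_injective : Function.Injective constEmb)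
    (hH : ∀ y : T.PiX, y ∈ T.PiYdd → ιX y ∈ (BiKummerSetting.mkOfTemperoid X tf hZ hP NH A₀ hA₀ hA₀').Hodot)
    (hconst : ∀ (e : Aut R.BN) (k : K'ˣ), tf.biratAutModel R.BN e (constEmb k) = constEmb k)
    (hgc : ∀ u : (ofTemperoidData h Q odd_l R ιX K' constEmb constEmb_injective (hinvc_ofTemperoid h hθ R)
          (hinvp_ofTemperoid h hθ' R ιX)).units
        (ofTemperoidData h Q odd_l R ιX K' constEmb constEmb_injective (hinvc_ofTemperoid h hθ R)
          (hinvp_ofTemperoid h hθ' R ιX)).BN,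
      (∀ y ∈ (ofTemperoidData h Q odd_l R ιX K' constEmb constEmb_injective (hinvc_ofTemperoid h hθ R)
          (hinvp_ofTemperoid h hθ' R ιX)).imPiY,
        (ofTemperoidData h Q odd_l R ιX K' constEmb constEmb_injective (hinvc_ofTemperoid h hθ R)
            (hinvp_ofTemperoid h hθ' R ιX)).sgpCap y *
          (u : Aut (ofTemperoidData h Q odd_l R ιX K' constEmb constEmb_injective (hinvc_ofTemperoid h hθ R)
            (hinvp_ofTemperoid h hθ' R ιX)).BN) *
          ((ofTemperoidData h Q odd_l R ιX K' constEmb constEmb_injective (hinvc_ofTemperoid h hθ R)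
            (hinvp_ofTemperoid h hθ' R ιX)).sgpCap y)⁻¹ = u) →
      (ofTemperoidData h Q odd_l R ιX K' constEmb constEmb_injective (hinvc_ofTemperoid h hθ R)
          (hinvp_ofTemperoid h hθ' R ιX)).unitsToBirat
          (ofTemperoidData h Q odd_l R ιX K' constEmb constEmb_injective (hinvc_ofTemperoid h hθ R)
            (hinvp_ofTemperoid h hθ' R ιX)).BN u ∈
        (ofTemperoidData h Q odd_l R ιX K' constEmb constEmb_injective (hinvc_ofTemperoid h hθ R)
          (hinvp_ofTemperoid h hθ' R ιX)).constEmb.range) :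
    (ofTemperoidData h Q odd_l R ιX K' constEmb constEmb_injective (hinvc_ofTemperoid h hθ R)
      (hinvp_ofTemperoid h hθ' R ιX)).Facts :=
  facts_ofTemperoidData h Q odd_l R ιX K' constEmb constEmb_injective _ _ hH hconst hgc

end OneLevel

section Family

variable {E : Set ℕ+} {𝒯 : ThetaEnvTower.{max u₀ w} E}
  (R : ∀ N : ℕ+, (BiKummerSetting.mkOfTemperoid X tf hZ hP NH A₀ hA₀ hA₀').NthRoot Rl.root Rl.pair N pullFrac)
  (ιX : 𝒯.PiX ≃ₜ* X.Pi)

include h hθ in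
/-- **`hinvc` of `ofTemperoidFamily` at every level from the stability of `Div(Θ̈)₊`.** [cite: MochizukiEtTh2009, §5 p.330 (PDF p.104)] -/
theorem hinvc_family_ofTemperoid (N : ℕ+) (g : Aut (R N).AN.base) :
    pull tf.divisorMonoid g.hom (ModelFrobenioid.div (R N).pair.num) = ModelFrobenioid.div (R N).pair.num :=
  hinvc_of_thetaDivisor (R N) h.isDivisorial (BiKummerSetting.mkOfTemperoid_galoisSurj_natural X tf hZ hP NH A₀ hA₀ hA₀')
    hθ g

include h hθ' in
/-- **`hinvp` of `ofTemperoidFamily` at every level from the stability of `Div(Θ̈)₋`** (for all `y ∈ Π^tp_X`, in particular on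
`Π^tp_Ÿ`).  [cite: MochizukiEtTh2009, Prop 4.3 (i) p.317 (PDF p.91)] -/
theorem hinvp_family_ofTemperoid (N : ℕ+) (y : 𝒯.PiX) (_hy : y ∈ 𝒯.PiYdd) :
    pull tf.divisorMonoid (galoisSurjOf X.isTempered (R N).AN.base (R N).αData.isGalois (ιX y)).hom
      (ModelFrobenioid.div (R N).pair.den) = ModelFrobenioid.div (R N).pair.den :=
  BiKummerSetting.NthRoot.pull_galoisSurj_div_den (R N) Rl.αData.isGalois h.isDivisorial
    (BiKummerSetting.mkOfTemperoid_galoisSurj_natural X tf hZ hP NH A₀ hA₀ hA₀')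
    (BiKummerSetting.NthRoot.pull_galoisSurj_div_den Rl hA₀' h.isDivisorial
      (BiKummerSetting.mkOfTemperoid_galoisSurj_natural X tf hZ hP NH A₀ hA₀ hA₀') hθ') (ιX y)

end Family

end ThetaFrobenioid

end Literature.AnabelianGeometry.EtaleTheta

end
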